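import Literature.NumberTheory.LFunctions.ConreyIwaniec2002Proofs
import Literature.NumberTheory.LFunctions.ConreyIwaniec2002PropTenOneWeak
import HarnessLib

/-!
# Conrey–Iwaniec (2002), Corollary 10.2 (= Theorem 1.2, odd `q`) from the typed Proposition 9.1 alone

Conrey–Iwaniec, Acta Arith. 103 (2002), §10 [held text `paper:arxiv-math_0111012`, p0021]. The
tree's chain `Prop 9.2 ⟹ Prop 10.1 ⟹ Cor 10.2` starts from the typed Proposition 9.2, whose printed
derivation from Proposition 9.1 uses the unproved cosmetic claim of (9.11) (`Lq`, OPEN; see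
`ConreyIwaniec2002PrincipalEstimate.lean`). This file closes the same door WITHOUT `Lq`: typed
Proposition 9.1 ⟹ (9.12) with `(log q)^{7/2}` ⟹ Proposition 10.1 with `(log q)^{−(2A+7)}`
(`conreyIwaniec2002_proposition101_weak_of_proposition91`) ⟹ Corollary 10.2 AS TYPED: at
`A = 16`, `log T = (log q)^{22}` the weak Proposition 10.1 gives `(log q)^{−83} ≥ (log q)^{−90}`, so the
printed exponent `90` survives (plan-1 A2.4). The last step is the tree's
`conreyIwaniec2002_corollary102_of_proposition101` re-run verbatim on the weak hypothesis
(numerals `82 ↦ 83`). PROVED HERE (no named fact, no new definition):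
`ConreyIwaniec2002.corollary102_of_proposition101_weak` and
`conreyIwaniec2002_corollary102_of_proposition91 : conreyIwaniec2002_proposition91 → conreyIwaniec2002_corollary102`.

## References

* [ConreyIwaniec2002] B. Conrey, H. Iwaniec, Acta Arith. 103 (2002) 259–312, arXiv:math/0111012:
  Corollary 10.2 and its proof; Proposition 10.1.
-/

noncomputable section

open scoped NumberField
open Complex Set Metric MeromorphicOn

namespace Literature.NumberTheory.LFunctions

namespace ConreyIwaniec2002

/-- At most two pairwise `1`-separated positive reals lie below `2`. [folklore] -/
private theorem card_filter_not_two_le_le_two {S : Finset ℝ} (hpos : ∀ t ∈ S, 0 < t)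
    (hsep : ∀ t ∈ S, ∀ u ∈ S, t ≠ u → 1 ≤ |t - u|) :
    (S.filter (fun t => ¬ 2 ≤ t)).card ≤ 2 := by
  classical
  by_contra h
  obtain ⟨a, b, c, ha, hb, hc, hab, hac, hbc⟩ := Finset.two_lt_card_iff.1 (not_le.1 h)
  rw [Finset.mem_filter, not_le] at ha hb hc
  have ha0 := hpos a ha.1
  have hb0 := hpos b hb.1
  have hc0 := hpos c hc.1
  have h1 := hsep a ha.1 b hb.1 hab
  have h2 := hsep a ha.1 c hc.1 hac
  have h3 := hsep b hb.1 c hc.1 hbc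
  rcases le_abs.1 h1 with h1 | h1 <;> rcases le_abs.1 h2 with h2 | h2 <;>
    rcases le_abs.1 h3 with h3 | h3 <;> linarith [ha.2, hb.2, hc.2]

/-- For the finitely many moduli `q ≤ Q` and their finitely many characters `χ ≠ 1`, `‖L(1,χ)‖` is
bounded below by one positive constant (`L(1,χ) ≠ 0`, Dirichlet). [folklore] -/
private theorem exists_pos_forall_le_norm_LFunction_one (Q : ℕ) :
    ∃ m : ℝ, 0 < m ∧ ∀ (q : ℕ) [NeZero q], q ≤ Q →
      ∀ χ : DirichletCharacter ℂ q, χ ≠ 1 → m ≤ ‖χ.LFunction 1‖ := by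
  classical
  induction Q with
  | zero =>
    refine ⟨1, one_pos, fun q _ hq χ _ => ?_⟩
    exact absurd (Nat.le_zero.1 hq) (NeZero.ne q)
  | succ Q ih =>
    obtain ⟨m₁, hm₁, h₁⟩ := ih
    have hfin : ∀ s : Finset (DirichletCharacter ℂ (Q + 1)), ∃ m : ℝ, 0 < m ∧
        ∀ χ ∈ s, χ ≠ 1 → m ≤ ‖χ.LFunction 1‖ := by
      intro s
      induction s using Finset.induction_on with
      | empty => exact ⟨1, one_pos, fun χ hχ => absurd hχ (Finset.notMem_empty _)⟩
      | insert a s ha ih' =>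
        obtain ⟨m, hm, hs⟩ := ih'
        by_cases ha1 : a = 1
        · refine ⟨m, hm, fun χ hχ hχ1 => ?_⟩
          rcases Finset.mem_insert.1 hχ with rfl | hχ'
          · exact absurd ha1 hχ1
          · exact hs χ hχ' hχ1
        · refine ⟨min m ‖a.LFunction 1‖,
            lt_min hm (norm_pos_iff.2 (DirichletCharacter.LFunction_apply_one_ne_zero ha1)),
            fun χ hχ hχ1 => ?_⟩
          rcases Finset.mem_insert.1 hχ with rfl | hχ'
          · exact min_le_right _ _
          · exact (min_le_left _ _).trans (hs χ hχ' hχ1)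
    haveI : Fintype (DirichletCharacter ℂ (Q + 1)) := Fintype.ofFinite _
    obtain ⟨m₂, hm₂, h₂⟩ := hfin Finset.univ
    refine ⟨min m₁ m₂, lt_min hm₁ hm₂, fun q _ hq χ hχ => ?_⟩
    rcases Nat.lt_or_ge q (Q + 1) with hlt | hge
    · exact (min_le_left _ _).trans (h₁ q (Nat.lt_succ_iff.1 hlt) χ hχ)
    · have hqe : q = Q + 1 := le_antisymm hq hge
      subst hqe
      exact (min_le_right _ _).trans (h₂ χ (Finset.mem_univ _) hχ)
end ConreyIwaniec2002

open ConreyIwaniec2002 NumberField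

/-! ### Corollary 10.2 from the weak Proposition 10.1 -/

/-- An odd Dirichlet character is not trivial. [folklore] -/
private theorem DirichletCharacter.Odd.ne_one' {q : ℕ} [NeZero q] {χ : DirichletCharacter ℂ q}
    (hodd : χ.Odd) : χ ≠ 1 := by
  rintro rfl
  have h : ((1 : DirichletCharacter ℂ q) (-1) : ℂ) = -1 := hodd
  rw [MulChar.one_apply isUnit_one.neg] at h
  norm_num at h

/-- **Corollary 10.2 follows from the WEAK Proposition 10.1 (`(log q)^{−(2A+7)}`)** — the tree's
printed deduction `conreyIwaniec2002_corollary102_of_proposition101` verbatim (`ψ = 1`,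
`L = ζ_K = ζ · L(·,χ)`; well-spaced subselection; `log T = (log q)^{22}`, `α = (log T)^{−1/2}`,
`A = 16`; small `q` by positivity of `L(1,χ)`): the weak exponent gives `(log q)^{−83}` in place of
`(log q)^{−82}`, still `≥ (log q)^{−90}` — the printed exponent `90` of (10.15)/(1.23) is UNCHANGED
(plan-1 A2.4). [cite: ConreyIwaniec2002, Corollary 10.2 (proof)] -/
theorem ConreyIwaniec2002.corollary102_of_proposition101_weak
    (h : ∃ c : ℝ, 0 < c ∧
    ∀ A : ℝ, 0 ≤ A →
      ∀ (q : ℕ) [NeZero q], 4 < q → Odd q → ∀ χ : DirichletCharacter ℂ q,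
        χ.IsPrimitive → χ.IsQuadratic → χ.Odd →
          ∀ (K : Type) [Field K] [NumberField K],
            Module.finrank ℚ K = 2 → NumberField.discr K = -(q : ℤ) →
              ∀ (ψ : ClassGroup (𝓞 K) →* ℂˣ) (T α : ℝ) (S : Finset ℝ) (t' : ℝ → ℝ),
                2 ≤ T → 0 < α → α ≤ 1 → Real.log q ^ (A + 6) ≤ Real.log T →
                  IsPointSet S T →
                    (∀ t ∈ S, |t - t' t| ≤ gapRadius α t) →
                      (∀ t ∈ S, ‖dividedDifference (classGroupLFunction K ψ)
                          (1 / 2 + t * I) (1 / 2 + t' t * I)‖ ≤ Real.log q ^ ((7 : ℝ) / 2)) →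
                        c * T / (α * Real.log q ^ A) ≤ (S.card : ℝ) →
                          Real.log T ^ (-(2 : ℝ)) * Real.log q ^ (-(2 * A + 7)) ≤
                            ‖χ.LFunction 1‖) :
    conreyIwaniec2002_corollary102 := by
  classical
  obtain ⟨c₀, hc₀, hP⟩ := h
  obtain ⟨C, hC0, hC⟩ := exists_sum_zetaZeroWindow_le
  intro c hc
  -- thresholds: `q` is "large" when `(c / 4C) (log q)^{3/5} > c₀ + 1`
  set B : ℝ := (c₀ + 1) * (4 * C) / c with hB
  have hB0 : 0 < B := by positivity
  set Λ : ℝ := B ^ ((5 : ℝ) / 3) with hΛ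
  have hΛ0 : 0 ≤ Λ := Real.rpow_nonneg hB0.le _
  set Q : ℕ := ⌈Real.exp Λ⌉₊ with hQ
  obtain ⟨m, hm0, hm⟩ := exists_pos_forall_le_norm_LFunction_one Q
  refine ⟨min 1 m, lt_min one_pos hm0, fun hyp q _ hq hoddq χ hprim hquad hodd => ?_⟩
  have hχ1 : χ ≠ 1 := DirichletCharacter.Odd.ne_one' hodd
  have hq5 : (5 : ℝ) ≤ q := by exact_mod_cast hq
  have hq0 : (0 : ℝ) < q := by linarith
  -- `log q > 3/2` (`e^{3/2} < 5`)
  have hℓ : (3 : ℝ) / 2 < Real.log q := by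
    rw [Real.lt_log_iff_exp_lt hq0]
    have h3 : Real.exp 3 < 25 := by
      have h1 := Real.exp_one_lt_d9
      have h1' := Real.exp_pos 1
      have heq : Real.exp 3 = Real.exp 1 ^ 3 := by
        rw [← Real.exp_nat_mul]; norm_num
      rw [heq]
      have h4 : Real.exp 1 ^ 3 < (2.7182818286 : ℝ) ^ 3 := pow_lt_pow_left₀ h1 h1'.le (by norm_num)
      have h5 : (2.7182818286 : ℝ) ^ 3 < 25 := by norm_num
      exact h4.trans h5
    have hsq : Real.exp (3 / 2) ^ 2 < (5 : ℝ) ^ 2 := by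
      rw [← Real.exp_nat_mul]; norm_num; linarith
    exact (lt_of_pow_lt_pow_left₀ 2 (by norm_num) hsq).trans_le hq5
  set ℓ : ℝ := Real.log q with hℓdef
  have hℓ1 : 1 ≤ ℓ := by linarith
  have hℓ0 : 0 < ℓ := by linarith
  have hsmallineq : min 1 m * ℓ ^ (-(90 : ℝ)) ≤ min 1 m := by
    have h1 : ℓ ^ (-(90 : ℝ)) ≤ 1 := Real.rpow_le_one_of_one_le_of_nonpos hℓ1 (by norm_num)
    have h0 : 0 < min 1 m := lt_min one_pos hm0
    nlinarith
  by_cases hqQ : q ≤ Q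
  · -- small `q`: "adjusting the implied constant"
    calc min 1 m * ℓ ^ (-(90 : ℝ)) ≤ min 1 m := hsmallineq
      _ ≤ m := min_le_right _ _
      _ ≤ ‖χ.LFunction 1‖ := hm q hqQ χ hχ1
  -- large `q`: `Λ < ℓ`, i.e. `B < ℓ^{3/5}`
  have hΛℓ : Λ < ℓ := by
    have h1 : Real.exp Λ < q :=
      calc Real.exp Λ ≤ Q := Nat.le_ceil _
        _ < q := by exact_mod_cast not_le.1 hqQ
    exact (Real.lt_log_iff_exp_lt hq0).2 h1
  -- `x = ℓ^{1/5}`: all the exponents below become natural powers of `x`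
  set x : ℝ := ℓ ^ ((1 : ℝ) / 5) with hxdef
  have hx0 : 0 < x := Real.rpow_pos_of_pos hℓ0 _
  have hx1 : 1 < x := Real.one_lt_rpow (by linarith) (by norm_num)
  have hx5 : x ^ 5 = ℓ := by
    rw [hxdef, ← Real.rpow_natCast, ← Real.rpow_mul hℓ0.le]; norm_num
  have hx3 : B < x ^ 3 := by
    have h1 : Λ ^ ((3 : ℝ) / 5) < ℓ ^ ((3 : ℝ) / 5) := Real.rpow_lt_rpow hΛ0 hΛℓ (by norm_num)
    have h2 : Λ ^ ((3 : ℝ) / 5) = B := by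
      rw [hΛ, ← Real.rpow_mul hB0.le]; norm_num
    have h3 : ℓ ^ ((3 : ℝ) / 5) = x ^ 3 := by
      rw [hxdef, ← Real.rpow_natCast, ← Real.rpow_mul hℓ0.le]; norm_num
    rw [h2, h3] at h1
    exact h1
  -- heights: `L = log T = ℓ^{22} = x^{110}`, `T = e^L ≥ 2001`
  set L : ℝ := ℓ ^ 22 with hLdef
  have hLx : L = x ^ 110 := by rw [hLdef, ← hx5]; ring
  have hL2000 : 2000 < L := by
    have h1 : ((3 : ℝ) / 2) ^ 22 < ℓ ^ 22 := pow_lt_pow_left₀ hℓ (by norm_num) (by norm_num)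
    have h2 : (2000 : ℝ) < ((3 : ℝ) / 2) ^ 22 := by norm_num
    rw [hLdef]; linarith
  have hL1 : 1 ≤ L := by linarith
  set T : ℝ := Real.exp L with hTdef
  have hT0 : 0 < T := Real.exp_pos L
  have hTL : L + 1 ≤ T := Real.add_one_le_exp L
  have hT2001 : 2001 ≤ T := by linarith
  have hT2 : (2 : ℝ) ≤ T := by linarith
  have hlogT : Real.log T = L := Real.log_exp L
  -- `α = (log T)^{-1/2} = x^{-55}`
  have hsqrtL : Real.sqrt L = x ^ 55 := by
    rw [hLx, show (x ^ 110 : ℝ) = (x ^ 55) ^ 2 by ring, Real.sqrt_sq (pow_nonneg hx0.le 55)]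
  set α : ℝ := (Real.sqrt L)⁻¹ with hαdef
  have hα0 : 0 < α := by rw [hαdef, hsqrtL]; positivity
  have hα1 : α ≤ 1 := by
    rw [hαdef, hsqrtL]; exact inv_le_one_of_one_le₀ (one_le_pow₀ hx1.le)
  -- the zeros counted by (10.14) at height `T`
  have hN := hyp T hT2001
  have hlog45 : Real.log T ^ ((4 : ℝ) / 5) = x ^ 88 := by
    rw [hlogT, hLx, ← Real.rpow_natCast x 110, ← Real.rpow_mul hx0.le]
    norm_num
  have hcount : c * T * x ^ 88 ≤ ((closeCriticalZeros T).ncard : ℝ) := by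
    rw [← hlog45]; exact hN
  have hpos : (0 : ℝ) < (closeCriticalZeros T).ncard := lt_of_lt_of_le (by positivity) hcount
  have hfin : (closeCriticalZeros T).Finite :=
    Set.finite_of_ncard_ne_zero (by exact_mod_cast hpos.ne')
  set Z : Finset ℝ := hfin.toFinset with hZdef
  have hZcard : ((closeCriticalZeros T).ncard : ℝ) = Z.card := by
    rw [hZdef, Set.ncard_eq_toFinset_card _ hfin]
  have hZ : ∀ γ ∈ Z, 0 < γ ∧ γ ≤ T ∧ HasCloseCriticalNeighbour γ := by
    intro γ hγ
    rw [hZdef, Set.Finite.mem_toFinset] at hγ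
    exact hγ
  have hZ' : ∀ γ ∈ Z, 0 < γ ∧ γ ≤ T ∧ riemannZeta (1 / 2 + γ * I) = 0 :=
    fun γ hγ => ⟨(hZ γ hγ).1, (hZ γ hγ).2.1, (hZ γ hγ).2.2.1⟩
  -- Step 2: `≤ C log(T+3) ≤ 2 C L` ordinates per window
  have hlogT3 : Real.log (T + 3) ≤ 2 * L := by
    have h1 : Real.log (T + 3) ≤ Real.log (2 * T) := Real.log_le_log (by linarith) (by linarith)
    rw [Real.log_mul two_ne_zero hT0.ne', hlogT] at h1
    linarith [Real.log_two_lt_d9]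
  have hfib : ∀ k : ℤ, ((Z.filter (fun γ => round γ = k)).card : ℝ) ≤ C * Real.log (T + 3) :=
    card_filter_round_eq_le hC0 hC hT0 Z hZ'
  -- Step 3: well-spaced subselection, then discard the (at most two) ordinates below `2`
  obtain ⟨S₀, hS₀Z, hS₀sep, hS₀card⟩ := exists_separated_subset Z hfib
  set S : Finset ℝ := S₀.filter (fun t => 2 ≤ t) with hSdef
  have hS₀pos : ∀ t ∈ S₀, 0 < t := fun t ht => (hZ t (hS₀Z ht)).1
  have hsmall : (S₀.filter (fun t => ¬ 2 ≤ t)).card ≤ 2 :=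
    card_filter_not_two_le_le_two hS₀pos hS₀sep
  have hScard : (S₀.card : ℝ) ≤ S.card + 2 := by
    have hsplit := Finset.card_filter_add_card_filter_not (s := S₀) (fun t : ℝ => 2 ≤ t)
    have h' : S₀.card ≤ S.card + 2 := by rw [hSdef]; omega
    exact_mod_cast h'
  have hmemS : ∀ t ∈ S, t ∈ S₀ ∧ 2 ≤ t := fun t ht => Finset.mem_filter.1 ht
  -- companions: the nearest critical zero within `ciRadius`, or the point itself if multiple
  have hcomp : ∀ γ : ℝ, ∃ γ' : ℝ, HasCloseCriticalNeighbour γ →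
      (γ' = γ ∧ deriv riemannZeta (1 / 2 + γ * I) = 0) ∨
        (γ' ≠ γ ∧ riemannZeta (1 / 2 + γ' * I) = 0 ∧ |γ - γ'| ≤ ciRadius γ) := by
    intro γ
    by_cases hex : ∃ γ' : ℝ, γ' ≠ γ ∧ riemannZeta (1 / 2 + γ' * I) = 0 ∧ |γ - γ'| ≤ ciRadius γ
    · obtain ⟨γ', hγ'⟩ := hex
      exact ⟨γ', fun _ => Or.inr hγ'⟩
    · exact ⟨γ, fun hγ => Or.inl ⟨rfl, hγ.2.resolve_right hex⟩⟩
  choose t' ht' using hcomp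
  -- Step 1: the field `K = ℚ(√−q)` and `L(s, 1) = ζ_K(s) = ζ(s) L(s, χ)` off `s = 1`
  obtain ⟨K, hK₁, hK₂, h2, hdisc⟩ :=
    Literature.NumberTheory.QuadraticFields.Quadratic.exists_quadraticField_of_odd_primitive
      hprim hquad hodd
  have hfacL : ∀ s : ℂ, 1 < s.re →
      NumberField.dedekindZeta K s = riemannZeta s * LSeries (fun n ↦ χ n) s := by
    intro s hs
    rw [Literature.NumberTheory.QuadraticFields.Quadratic.dedekindZeta_eq_riemannZeta_mul_LFunction_of_odd_primitive
        hprim hquad hodd h2 hdisc hs, DirichletCharacter.LFunction_eq_LSeries χ hs]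
  have hfacC : ∀ s : ℂ, s ≠ 1 → classGroupLFunction K 1 s = riemannZeta s * χ.LFunction s := by
    intro s hs
    rw [classGroupLFunction_one K hs,
      Literature.NumberTheory.QuadraticFields.Quadratic.dedekindZetaCont_eq_riemannZeta_mul_LFunction
        hχ1 hfacL hs]
  -- the hypotheses of Proposition 10.1 (`A = 16`, `ψ = 1`)
  have hlogTq : Real.log q ^ ((16 : ℝ) + 6) ≤ Real.log T := by
    rw [hlogT, hLdef, show ((16 : ℝ) + 6) = ((22 : ℕ) : ℝ) by norm_num, Real.rpow_natCast]
  have hS : IsPointSet S T := by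
    refine ⟨fun t ht => ⟨(hmemS t ht).2, (hZ t (hS₀Z (hmemS t ht).1)).2.1⟩, ?_⟩
    intro t ht u hu htu
    exact hS₀sep t (hmemS t ht).1 u (hmemS u hu).1 htu
  have h10 : ∀ t ∈ S, |t - t' t| ≤ gapRadius α t := by
    intro t ht
    obtain ⟨ht₀, ht2⟩ := hmemS t ht
    obtain ⟨-, htT, hclose⟩ := hZ t (hS₀Z ht₀)
    have hlt0 : 0 < Real.log t := Real.log_pos (by linarith)
    have hgap0 : 0 ≤ gapRadius α t := by
      unfold gapRadius
      exact div_nonneg (mul_nonneg Real.pi_pos.le (by linarith)) hlt0.le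
    rcases ht' t hclose with ⟨heq, -⟩ | ⟨-, -, hr⟩
    · rw [heq, sub_self, abs_zero]; exact hgap0
    · refine hr.trans ?_
      have hltL : Real.log t ≤ L := by
        rw [← hlogT]; exact Real.log_le_log (by linarith) htT
      have hsqrt_pos : 0 < Real.sqrt (Real.log t) := Real.sqrt_pos.2 hlt0
      have hα_le : α ≤ 1 / Real.sqrt (Real.log t) := by
        rw [hαdef, one_div]
        exact inv_anti₀ hsqrt_pos (Real.sqrt_le_sqrt hltL)
      unfold ciRadius gapRadius
      rw [div_mul_eq_mul_div]
      exact div_le_div_of_nonneg_right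
        (mul_le_mul_of_nonneg_left (by linarith) Real.pi_pos.le) hlt0.le
  have h11 : ∀ t ∈ S, ‖dividedDifference (classGroupLFunction K 1) (1 / 2 + t * I)
      (1 / 2 + t' t * I)‖ ≤ Real.log q ^ ((7 : ℝ) / 2) := by
    intro t ht
    obtain ⟨ht₀, -⟩ := hmemS t ht
    obtain ⟨-, -, hclose⟩ := hZ t (hS₀Z ht₀)
    have hζ : riemannZeta (1 / 2 + t * I) = 0 := hclose.1
    have hρ1 : (1 / 2 + t * I : ℂ) ≠ 1 := ne_one_of_riemannZeta_eq_zero hζ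
    suffices h0 : dividedDifference (classGroupLFunction K 1) (1 / 2 + t * I)
        (1 / 2 + t' t * I) = 0 by
      rw [h0, norm_zero]; exact Real.rpow_nonneg hℓ0.le _
    rcases ht' t hclose with ⟨heq, hder⟩ | ⟨hne, hζ', -⟩
    · rw [heq, dividedDifference_self]
      have hev : classGroupLFunction K 1 =ᶠ[nhds (1 / 2 + t * I)]
          fun s => riemannZeta s * χ.LFunction s := by
        filter_upwards [isOpen_ne.mem_nhds hρ1] with s hs using hfacC s hs
      rw [hev.deriv_eq, deriv_fun_mul (differentiableAt_riemannZeta hρ1)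
        ((DirichletCharacter.differentiable_LFunction hχ1) _), hζ, hder]
      simp
    · have hne' : (1 / 2 + t' t * I : ℂ) ≠ 1 / 2 + t * I := by
        intro he
        apply hne
        have him := congrArg Complex.im he
        simpa using him
      refine dividedDifference_eq_zero_of_zeros _ hne' ?_ ?_
      · rw [hfacC _ hρ1, hζ, zero_mul]
      · rw [hfacC _ (ne_one_of_riemannZeta_eq_zero hζ'), hζ', zero_mul]
  have h12 : c₀ * T / (α * Real.log q ^ (16 : ℝ)) ≤ (S.card : ℝ) := by
    have hℓ16 : Real.log q ^ (16 : ℝ) = x ^ 80 := by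
      rw [← hℓdef, show (16 : ℝ) = ((16 : ℕ) : ℝ) by norm_num, Real.rpow_natCast, ← hx5]; ring
    have hA : c * T * x ^ 88 ≤ 4 * C * x ^ 110 * S₀.card := by
      have h1 : c * T * x ^ 88 ≤ 2 * (C * Real.log (T + 3)) * S₀.card :=
        calc c * T * x ^ 88 ≤ Z.card := by rw [← hZcard]; exact hcount
          _ ≤ _ := hS₀card
      have h2 : 2 * (C * Real.log (T + 3)) * (S₀.card : ℝ) ≤ 4 * C * x ^ 110 * S₀.card := by
        have h3 : C * Real.log (T + 3) ≤ C * (2 * L) := mul_le_mul_of_nonneg_left hlogT3 hC0.le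
        have h4 : (0 : ℝ) ≤ S₀.card := Nat.cast_nonneg _
        rw [hLx] at h3
        nlinarith
      exact h1.trans h2
    have hx85 : 2 ≤ x ^ 85 := by
      have h1 : ((3 : ℝ) / 2) ^ 17 < (x ^ 5) ^ 17 :=
        pow_lt_pow_left₀ (by rw [hx5]; exact hℓ) (by norm_num) (by norm_num)
      have h2 : (2 : ℝ) ≤ ((3 : ℝ) / 2) ^ 17 := by norm_num
      calc (2 : ℝ) ≤ ((3 : ℝ) / 2) ^ 17 := h2
        _ ≤ (x ^ 5) ^ 17 := h1.le
        _ = x ^ 85 := by ring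
    have hT25 : 2 * x ^ 25 ≤ T :=
      calc 2 * x ^ 25 ≤ x ^ 85 * x ^ 25 := mul_le_mul_of_nonneg_right hx85 (by positivity)
        _ = L := by rw [hLx]; ring
        _ ≤ T := by linarith
    have hB' : (c₀ + 1) * (4 * C) < c * x ^ 3 := by
      have h1 := hx3
      rw [hB, div_lt_iff₀ hc] at h1
      linarith
    have hpos88 : 0 < 4 * C * x ^ 88 := by positivity
    have key : (c₀ + 1) * T ≤ x ^ 25 * S₀.card := by
      have h2 : (c₀ + 1) * T * (4 * C * x ^ 88) ≤ x ^ 25 * S₀.card * (4 * C * x ^ 88) :=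
        calc (c₀ + 1) * T * (4 * C * x ^ 88) = (c₀ + 1) * (4 * C) * (T * x ^ 88) := by ring
          _ ≤ c * x ^ 3 * (T * x ^ 88) := mul_le_mul_of_nonneg_right hB'.le (by positivity)
          _ = x ^ 3 * (c * T * x ^ 88) := by ring
          _ ≤ x ^ 3 * (4 * C * x ^ 110 * S₀.card) := mul_le_mul_of_nonneg_left hA (by positivity)
          _ = x ^ 25 * S₀.card * (4 * C * x ^ 88) := by ring
      exact le_of_mul_le_mul_right h2 hpos88
    rw [hℓ16, hαdef, hsqrtL, div_le_iff₀ (by positivity)]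
    have hx25 : (x ^ 55)⁻¹ * x ^ 80 = x ^ 25 := by
      field_simp
    rw [hx25]
    calc c₀ * T = (c₀ + 1) * T - T := by ring
      _ ≤ x ^ 25 * S₀.card - 2 * x ^ 25 := by linarith
      _ = x ^ 25 * (S₀.card - 2) := by ring
      _ ≤ x ^ 25 * S.card := mul_le_mul_of_nonneg_left (by linarith) (by positivity)
      _ = S.card * x ^ 25 := by ring
  -- Proposition 10.1
  have hres := hP 16 (by norm_num) q hq hoddq χ hprim hquad hodd K h2 hdisc 1 T α S t'
    hT2 hα0 hα1 hlogTq hS h10 h11 h12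
  have hval : Real.log T ^ (-(2 : ℝ)) * Real.log q ^ (-(2 * 16 + 7) : ℝ) = ℓ ^ (-(83 : ℝ)) := by
    rw [hlogT, hLdef, ← Real.rpow_natCast ℓ 22, ← Real.rpow_mul hℓ0.le, ← hℓdef,
      ← Real.rpow_add hℓ0]
    norm_num
  calc min 1 m * ℓ ^ (-(90 : ℝ)) ≤ 1 * ℓ ^ (-(83 : ℝ)) :=
        mul_le_mul (min_le_left 1 m) (Real.rpow_le_rpow_of_exponent_le hℓ1 (by norm_num))
          (Real.rpow_nonneg hℓ0.le _) zero_le_one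
    _ = Real.log T ^ (-(2 : ℝ)) * Real.log q ^ (-(2 * 16 + 7) : ℝ) := by rw [one_mul, hval]
    _ ≤ ‖χ.LFunction 1‖ := hres

/-! ### Corollary 1.3 (odd `q`) from Proposition 10.1 -/

/-- **Theorem 1.2 for odd `q` (Corollary 10.2) from the typed Proposition 9.1 alone** (no `Lq`).
[cite: ConreyIwaniec2002, Corollary 10.2] -/
theorem conreyIwaniec2002_corollary102_of_proposition91 (h91 : conreyIwaniec2002_proposition91) :
    conreyIwaniec2002_corollary102 :=
  corollary102_of_proposition101_weak (conreyIwaniec2002_proposition101_weak_of_proposition91 h91)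

end Literature.NumberTheory.LFunctions

end
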